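import Literature.Analysis.FluidPDE.OnsagerBDSVPerturbationSmooth
import Literature.Analysis.FluidPDE.OnsagerBDSVParameters
import Literature.Analysis.ODE.TorusTransportEstimates
import Literature.Analysis.FunctionSpaces.TorusHolderBridge
import HarnessLib

/-!
# The BDSV perturbation: Lemma 5.4, part I — deformation of the backward flows, `ρ_q`, `ρ_{q,i}`

Buckmaster–De Lellis–Székelyhidi–Vicol 2019, Lemma 5.4: for `a` large,
(5.14) `‖∇Φᵢ - Id‖₀ ≤ 1/2` for `t ∈ supp ηᵢ` ("by (2.19) and (B.4), `‖∇Φᵢ - Id‖₀ ≲ τ_q δ_q^{1/2} λ_q = ℓ^{2α}`"),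
(5.15) `δ_{q+1}/(8λ_q^α) ≤ |ρ_q(t)| ≤ δ_{q+1}`, (5.16) `‖ρ_{q,i}‖₀ ≤ δ_{q+1}/c₀`, and (5.19)
`c₀ ≤ ∑_i∫ηᵢ² ≤ 2`. For the construction of `OnsagerBDSVPerturbation.lean` (any
`BDSV.PerturbationData` under `BDSV.PerturbationHypotheses`) this file PROVES:

* `PerturbationHypotheses.abs_partialDeriv_vbar_le`: the pointwise bound `|∂ⱼv̄_k| ≤ C_in δ_q^{1/2}λ_q`
  read off (2.19)|_{N=0} (bridge `BDSV.norm_partialDeriv_le_of_eContDiffHolderNorm_le` from the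
  accepted `Torus.eContDiffHolderNorm` bounds to pointwise derivative bounds);
* `PerturbationData.abs_partialDeriv_D_le`: `|∂ⱼ(Φᵢ - id)_a(t,x)| ≤ exp(3K|t - tᵢ*|) - 1`,
  `K = C_in δ_q^{1/2}λ_q`, `tᵢ* = min(tᵢ, T)`, by the proved App. B (B.4)
  `Literature.Analysis.ODE.abs_partialDeriv_le_of_transport_id`; with the time localisation
  `CutoffFamily.abs_sub_anchor_le` (`ηᵢ(t,x) ≠ 0 ⇒ |t - tᵢ*| ≤ 4τ_q/3`) and `K τ_q = C_in ℓ^{2α}`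
  (`BDSV.velocityBound_mul_tau`) this is `PerturbationData.abs_partialDeriv_D_le_of_eta_ne_zero`:
  `|∂ⱼ(Φᵢ - id)_a| ≤ exp(4 C_in ℓ^{2α}) - 1` on `supp ηᵢ` — (5.14) up to the choice of `a`, which
  `BDSV.exists_threshold_mollScale_rpow_le` (`C ℓ_q^{2α} ≤ ε` for `a ≥ a₀`, all `q`) provides;
* `BDSV.exists_threshold_four_amp` (`4δ_{q+2} ≤ δ_{q+1}λ_q^{-α}` for `α < 2βb(b-1)`, `a ≥ a₁`),
  `PerturbationHypotheses.rhoQ_le` / `.le_rhoQ` = (5.15), `CutoffFamily.sum_sq_le_one` (pointwise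
  `∑ᵢηᵢ² ≤ 1` from (i)–(ii)), `PerturbationData.etaMass_le_one` / `.le_etaMass` = (5.19) (with the
  sharper `≤ 1`), `PerturbationData.rhoI_le` = (5.16).

Part II (the membership `R̃_{q,i} ∈ B̄(Id, 1/10)`, i.e. the last assertion of Lemma 5.4) and
Prop. 5.7 / Cor. 5.8 follow in later files.

## References

* T. Buckmaster, C. De Lellis, L. Székelyhidi Jr., V. Vicol, *Onsager's conjecture for admissible
  weak solutions*, Comm. Pure Appl. Math. 72 (2019) = arXiv:1701.08678, Lemma 5.4 and its proof,
  (5.14)–(5.16), (5.19); App. B (B.4); §2.4 (2.11); §2.5 (2.16), (2.19)–(2.20).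
-/

open MeasureTheory Set
open scoped NNReal ENNReal ContDiff Matrix Matrix.Norms.Elementwise

noncomputable section

namespace Literature.Analysis.FluidPDE

namespace BDSV

open FunctionSpaces FunctionSpaces.Torus

/-- The flat three-torus `T³ = (ℝ/ℤ)³`, local notation. -/
local notation "𝕋³" => UnitAddTorus (Fin 3)

/-- Euclidean `ℝ³`, local notation. -/
local notation "ℝ³" => EuclideanSpace ℝ (Fin 3)

/-! ## From `C^{1,0}` bounds to pointwise derivative bounds -/

section Bridge

variable {F : Type*} [NormedAddCommGroup F] [NormedSpace ℝ F]

/-- A bound `‖g‖_{C^{1,r}} ≤ B` with `0 ≤ B` gives the pointwise bounds `‖∂ᵢ g (x)‖ ≤ B` of the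
partial derivatives. [folklore] -/
theorem norm_partialDeriv_le_of_eContDiffHolderNorm_le {g : 𝕋³ → F} (hg : IsContDiff 1 g) {r : ℝ≥0}
    {B : ℝ} (hB : 0 ≤ B) (h : Torus.eContDiffHolderNorm 1 r g ≤ ENNReal.ofReal B) (i : Fin 3) (x : 𝕋³) :
    ‖partialDeriv i g x‖ ≤ B := by
  have h1 : ‖partialDeriv i g x‖ₑ ≤ ENNReal.ofReal B :=
    ((enorm_le_eSupNorm _ x).trans (eSupNorm_partialDeriv_le hg i r)).trans h
  rwa [← ofReal_norm, ENNReal.ofReal_le_ofReal_iff hB] at h1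

/-- A bound `‖g‖_{C^{0,r}} ≤ B` with `0 ≤ B` gives the pointwise bound `‖g (x)‖ ≤ B`. [folklore] -/
theorem norm_le_of_eContDiffHolderNorm_zero_le {g : 𝕋³ → F} {r : ℝ≥0} {B : ℝ} (hB : 0 ≤ B)
    (h : Torus.eContDiffHolderNorm 0 r g ≤ ENNReal.ofReal B) (x : 𝕋³) : ‖g x‖ ≤ B := by
  have h1 : ‖g x‖ₑ ≤ ENNReal.ofReal B :=
    ((enorm_le_eSupNorm _ x).trans (eSupNorm_le_eContDiffHolderNorm_zero g r)).trans h
  rwa [← ofReal_norm, ENNReal.ofReal_le_ofReal_iff hB] at h1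

end Bridge

/-! ## The deformation of the backward flows: `|∂ⱼ(Φᵢ - id)_a| ≤ exp(4 C_in ℓ^{2α}) - 1` on `supp ηᵢ` -/

section FlowBounds

variable {P : Params} {S : Setting} {Nbar : ℕ} {Cin C₀ c₀ : ℝ} {Cη : ℕ → ℕ → ℝ}

/-- The pointwise velocity-gradient bound extracted from (2.19)|_{N=0}: `|∂ⱼ v̄_k| ≤ C_in δ_q^{1/2} λ_q`
on `[0,T] × T³` (for `C_in ≥ 0`, `a ≥ 1`). [cite: BuckmasterEtAl2018, §2.5 (2.19)] -/
theorem PerturbationHypotheses.abs_partialDeriv_vbar_le (H : PerturbationHypotheses P S Nbar Cin C₀)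
    (hCin : 0 ≤ Cin) (ha : 1 ≤ P.a) {s : ℝ} (hs : s ∈ Icc 0 S.T) (x : 𝕋³) (j k : Fin 3) :
    |partialDeriv j (S.vbar s) x k| ≤ Cin * (Real.sqrt (amp P.β P.a P.b S.q) * freq P.a P.b S.q) := by
  have hv := H.velocity 0 (Nat.zero_le _) s hs
  simp only [Nat.cast_zero, neg_zero, Real.rpow_zero, mul_one] at hv
  have hB : 0 ≤ Cin * (Real.sqrt (amp P.β P.a P.b S.q) * freq P.a P.b S.q) :=
    mul_nonneg hCin (mul_nonneg (Real.sqrt_nonneg _) (freq_pos ha _).le)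
  have h1 := norm_partialDeriv_le_of_eContDiffHolderNorm_le
    ((H.eulerReynolds.smooth_velocity.isSmooth_slice hs).isContDiff (by simp)) hB hv j x
  have h2 : |partialDeriv j (S.vbar s) x k| ≤ ‖partialDeriv j (S.vbar s) x‖ := by
    rw [← Real.norm_eq_abs]
    exact PiLp.norm_apply_le _ k
  exact h2.trans h1


/-- **Deformation of the backward flows along `[0,T]`** (BDSV Lemma 5.4, first display, via
App. B (B.4)): `|∂ⱼ(Φᵢ - id)_a(t, x)| ≤ exp(3 K |t - tᵢ*|) - 1` with `K = C_in δ_q^{1/2} λ_q` the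
bound of (2.19)|₀ and `tᵢ* = min(tᵢ, T)` the anchor of `Φᵢ`. [cite: BuckmasterEtAl2018, Lemma 5.4 (5.14)] -/
theorem PerturbationData.abs_partialDeriv_D_le (H : PerturbationHypotheses P S Nbar Cin C₀)
    (𝒟 : PerturbationData P S c₀ Cη) (hCin : 0 ≤ Cin) (ha : 1 ≤ P.a) (i : ℕ) {t : ℝ} (ht : t ∈ Icc 0 S.T)
    (x : 𝕋³) (a j : Fin 3) :
    |partialDeriv j (𝒟.D i t) x a| ≤
      Real.exp (3 * (Cin * (Real.sqrt (amp P.β P.a P.b S.q) * freq P.a P.b S.q)) *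
        |t - min ((i : ℝ) * P.τ S.q) S.T|) - 1 := by
  have hτ : 0 < P.τ S.q := glueScale_pos ha S.q
  have hanchor : min ((i : ℝ) * P.τ S.q) S.T ∈ Icc 0 S.T :=
    ⟨le_min (mul_nonneg i.cast_nonneg hτ.le) H.pos_T.le, min_le_right _ _⟩
  have h := Literature.Analysis.ODE.abs_partialDeriv_le_of_transport_id H.pos_T
    H.eulerReynolds.smooth_velocity (𝒟.flow i).smooth hanchor (𝒟.flow i).anchor (𝒟.flow i).transport
    (mul_nonneg hCin (mul_nonneg (Real.sqrt_nonneg _) (freq_pos ha _).le))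
    (fun s hs y j' k => H.abs_partialDeriv_vbar_le hCin ha hs y j' k) ht x a j
  rw [Fintype.card_fin] at h
  norm_num at h
  exact h

/-- **Time localisation of the cut-offs**: if `ηᵢ(t, x) ≠ 0` with `t ∈ [0,T]` then
`|t - min(tᵢ, T)| ≤ 4τ/3`. [cite: BuckmasterEtAl2018, §5.2 (iv)] -/
theorem CutoffFamily.abs_sub_anchor_le {T τ c₀' : ℝ} {Cη' : ℕ → ℕ → ℝ} (hτ : 0 < τ)
    (cut : CutoffFamily T τ c₀' Cη') {i : ℕ} {t : ℝ} (ht : t ∈ Icc 0 T) {x : 𝕋³} (h : cut.η i t x ≠ 0) :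
    |t - min ((i : ℝ) * τ) T| ≤ 4 * τ / 3 := by
  obtain ⟨h1, h2⟩ := cut.support i t x h
  rw [abs_le]
  rcases le_total ((i : ℝ) * τ) T with hi | hi
  · rw [min_eq_left hi]; constructor <;> linarith
  · rw [min_eq_right hi]; constructor <;> linarith [ht.2]

/-- `K τ_q = C_in ℓ^{2α}`: the CFL-type identity behind Lemma 5.4 (`τ_q δ_q^{1/2} λ_q = ℓ^{2α}`). [cite: BuckmasterEtAl2018, Lemma 5.4 (proof)] -/
theorem velocityBound_mul_tau (ha : 1 ≤ P.a) (q : ℕ) :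
    Cin * (Real.sqrt (amp P.β P.a P.b q) * freq P.a P.b q) * P.τ q =
      Cin * mollScale P.β P.α P.a P.b q ^ (2 * P.α) := by
  have h1 : 0 < Real.sqrt (amp P.β P.a P.b q) := Real.sqrt_pos.2 (amp_pos ha q)
  have h2 : 0 < freq P.a P.b q := freq_pos ha q
  unfold Params.τ glueScale
  field_simp

/-- **Deformation on the support of the cut-offs**: if `ηᵢ(t, ·) ≠ 0` somewhere then
`|∂ⱼ(Φᵢ - id)_a(t, x)| ≤ exp(4 C_in ℓ^{2α}) - 1` for every `x` (BDSV Lemma 5.4: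
`‖∇Φᵢ - Id‖₀ ≲ τ_q δ_q^{1/2} λ_q = ℓ^{2α}` for `t ∈ supp ηᵢ`). [cite: BuckmasterEtAl2018, Lemma 5.4 (5.14)] -/
theorem PerturbationData.abs_partialDeriv_D_le_of_eta_ne_zero (H : PerturbationHypotheses P S Nbar Cin C₀)
    (𝒟 : PerturbationData P S c₀ Cη) (hCin : 0 ≤ Cin) (ha : 1 ≤ P.a) {i : ℕ} {t : ℝ} (ht : t ∈ Icc 0 S.T)
    {x' : 𝕋³} (hη : 𝒟.cut.η i t x' ≠ 0) (x : 𝕋³) (a j : Fin 3) :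
    |partialDeriv j (𝒟.D i t) x a| ≤ Real.exp (4 * (Cin * mollScale P.β P.α P.a P.b S.q ^ (2 * P.α))) - 1 := by
  have hτ : 0 < P.τ S.q := glueScale_pos ha S.q
  have hK : 0 ≤ Cin * (Real.sqrt (amp P.β P.a P.b S.q) * freq P.a P.b S.q) :=
    mul_nonneg hCin (mul_nonneg (Real.sqrt_nonneg _) (freq_pos ha _).le)
  have h1 := 𝒟.abs_partialDeriv_D_le H hCin ha i ht x a j
  have h2 := CutoffFamily.abs_sub_anchor_le hτ 𝒟.cut ht hη
  refine h1.trans (sub_le_sub_right (Real.exp_le_exp.2 ?_) _)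
  calc 3 * (Cin * (Real.sqrt (amp P.β P.a P.b S.q) * freq P.a P.b S.q)) * |t - min ((i : ℝ) * P.τ S.q) S.T|
      ≤ 3 * (Cin * (Real.sqrt (amp P.β P.a P.b S.q) * freq P.a P.b S.q)) * (4 * P.τ S.q / 3) :=
        mul_le_mul_of_nonneg_left h2 (by positivity)
    _ = 4 * (Cin * (Real.sqrt (amp P.β P.a P.b S.q) * freq P.a P.b S.q) * P.τ S.q) := by ring
    _ = 4 * (Cin * mollScale P.β P.α P.a P.b S.q ^ (2 * P.α)) := by rw [velocityBound_mul_tau ha]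

/-- **Smallness of `ℓ^{2α}` for large `a`**: for `0 < α`, `0 < β`, `1 ≤ b` and every `ε > 0` there is
`a₀ > 1` with `C ℓ_q^{2α} ≤ ε` for all `a ≥ a₀` and all `q` (`ℓ ≤ λ_q^{-1} ≤ (2πa)^{-1}`).
[cite: BuckmasterEtAl2018, §2.4 (2.11)] -/
theorem exists_threshold_mollScale_rpow_le {β b α : ℝ} (hβ : 0 ≤ β) (hb : 1 ≤ b) (hα : 0 < α) (C : ℝ)
    {ε : ℝ} (hε : 0 < ε) :
    ∃ a₀ : ℝ, 1 < a₀ ∧ ∀ a : ℝ, a₀ ≤ a → ∀ q : ℕ, C * mollScale β α a b q ^ (2 * α) ≤ ε := by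
  rcases le_or_gt C 0 with hC | hC
  · refine ⟨2, one_lt_two, fun a ha q => ?_⟩
    have : 0 ≤ mollScale β α a b q ^ (2 * α) := Real.rpow_nonneg (mollScale_pos (by linarith) q).le _
    nlinarith
  · -- choose `a₀` with `(2π a₀)^{-2α} ≤ ε / C`
    obtain ⟨A, hA1, hA⟩ : ∃ A : ℝ, 1 < A ∧ A ^ (-(2 * α)) ≤ ε / C := by
      refine ⟨max 2 ((ε / C) ^ (-(1 / (2 * α)))), lt_max_of_lt_left one_lt_two, ?_⟩
      have hεC : 0 < ε / C := div_pos hε hC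
      have hpos : 0 < (ε / C) ^ (-(1 / (2 * α))) := Real.rpow_pos_of_pos hεC _
      calc (max 2 ((ε / C) ^ (-(1 / (2 * α))))) ^ (-(2 * α))
          ≤ ((ε / C) ^ (-(1 / (2 * α)))) ^ (-(2 * α)) :=
            Real.rpow_le_rpow_of_nonpos hpos (le_max_right _ _) (by linarith)
        _ = ε / C := by
            rw [← Real.rpow_mul hεC.le, show (-(1 / (2 * α))) * (-(2 * α)) = 1 by field_simp, Real.rpow_one]
    refine ⟨A, hA1, fun a ha q => ?_⟩
    have ha1 : (1 : ℝ) ≤ a := hA1.le.trans ha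
    have hℓ : mollScale β α a b q ^ (2 * α) ≤ a ^ (-(2 * α)) := by
      have h1 : mollScale β α a b q ≤ (freq a b q)⁻¹ := mollScale_le_freq_inv ha1 hb hβ hα.le q
      have h2 : (freq a b q)⁻¹ ≤ a⁻¹ := by
        refine inv_anti₀ (by linarith) ?_
        calc a = 1 * a ^ (1 : ℝ) := by rw [one_mul, Real.rpow_one]
          _ ≤ 2 * Real.pi * a ^ (b ^ q) := by
              refine mul_le_mul (by linarith [Real.two_le_pi]) ?_ (by positivity) (by positivity)
              exact Real.rpow_le_rpow_of_exponent_le ha1 (one_le_pow₀ hb)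
          _ ≤ freq a b q := two_pi_mul_rpow_le_freq a b q
      calc mollScale β α a b q ^ (2 * α) ≤ (a⁻¹) ^ (2 * α) :=
            Real.rpow_le_rpow (mollScale_pos ha1 q).le (h1.trans h2) (by linarith)
        _ = a ^ (-(2 * α)) := by rw [Real.inv_rpow (by linarith), Real.rpow_neg (by linarith)]
    have hA' : a ^ (-(2 * α)) ≤ A ^ (-(2 * α)) := Real.rpow_le_rpow_of_nonpos (by linarith) ha (by linarith)
    calc C * mollScale β α a b q ^ (2 * α) ≤ C * (ε / C) :=
          mul_le_mul_of_nonneg_left ((hℓ.trans hA').trans hA) hC.le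
      _ = ε := by field_simp

end FlowBounds

/-! ## The energy densities `ρ_q`, `ρ_{q,i}` and the mass `∑∫η_j²` (BDSV Lemma 5.4 (5.15)–(5.16), (5.19)) -/

section Rho

variable {P : Params} {S : Setting} {Nbar : ℕ} {Cin C₀ c₀ : ℝ} {Cη : ℕ → ℕ → ℝ}

/-- **Parameter part of (5.15)**: for `α < 2βb(b-1)` and `a` large, `4δ_{q+2} ≤ δ_{q+1} λ_q^{-α}`
for all `q`. [cite: BuckmasterEtAl2018, Lemma 5.4 (5.15)] -/
theorem exists_threshold_four_amp {β b α : ℝ} (hb : 1 < b) (hαb : α < 2 * β * b * (b - 1)) :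
    ∃ a₁ : ℝ, 1 < a₁ ∧ ∀ a : ℝ, a₁ ≤ a → ∀ q : ℕ,
      4 * amp β a b (q + 2) ≤ amp β a b (q + 1) * freq a b q ^ (-α) := by
  have hE : α + b * (2 * β) + b ^ 2 * (-2 * β) < 0 := by nlinarith
  obtain ⟨a₁, ha₁, h⟩ := exists_freq_triple_le hb.le hE 4
  refine ⟨a₁, ha₁, fun a ha q => ?_⟩
  have ha1 : (1 : ℝ) ≤ a := ha₁.le.trans ha
  have h0 := freq_pos (b := b) ha1 q
  have h1 := freq_pos (b := b) ha1 (q + 1)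
  have hq := h a ha q
  have e0 : freq a b q ^ α * freq a b q ^ (-α) = 1 := by
    rw [← Real.rpow_add h0, add_neg_cancel, Real.rpow_zero]
  have e1 : freq a b (q + 1) ^ (2 * β) * freq a b (q + 1) ^ (-2 * β) = 1 := by
    rw [← Real.rpow_add h1, show 2 * β + -2 * β = 0 by ring, Real.rpow_zero]
  have hpos : 0 < freq a b q ^ (-α) * freq a b (q + 1) ^ (-2 * β) := by positivity
  have key := mul_le_mul_of_nonneg_right hq hpos.le
  rw [one_mul] at key
  unfold amp
  calc 4 * freq a b (q + 2) ^ (-2 * β)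
      = 4 * (freq a b q ^ α * freq a b (q + 1) ^ (2 * β) * freq a b (q + 2) ^ (-2 * β)) *
          (freq a b q ^ (-α) * freq a b (q + 1) ^ (-2 * β)) := by
        rw [show 4 * (freq a b q ^ α * freq a b (q + 1) ^ (2 * β) * freq a b (q + 2) ^ (-2 * β)) *
            (freq a b q ^ (-α) * freq a b (q + 1) ^ (-2 * β)) =
            4 * freq a b (q + 2) ^ (-2 * β) * (freq a b q ^ α * freq a b q ^ (-α)) *
              (freq a b (q + 1) ^ (2 * β) * freq a b (q + 1) ^ (-2 * β)) by ring, e0, e1]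
        ring
    _ ≤ freq a b q ^ (-α) * freq a b (q + 1) ^ (-2 * β) := key
    _ = freq a b (q + 1) ^ (-2 * β) * freq a b q ^ (-α) := mul_comm _ _

/-- **(5.15), upper half**: `ρ_q(t) ≤ δ_{q+1}` on `[0,T]` (from (5.2) and `δ_{q+2} ≥ 0`). [cite: BuckmasterEtAl2018, Lemma 5.4 (5.15)] -/
theorem PerturbationHypotheses.rhoQ_le (H : PerturbationHypotheses P S Nbar Cin C₀) (ha : 1 ≤ P.a)
    {t : ℝ} (ht : t ∈ Icc 0 S.T) : rhoQ P S t ≤ amp P.β P.a P.b (S.q + 1) := by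
  have h1 := (H.energy_gap t ht).2
  have h2 : 0 ≤ amp P.β P.a P.b (S.q + 2) := (amp_pos ha _).le
  have h3 : 0 ≤ amp P.β P.a P.b (S.q + 1) := (amp_pos ha _).le
  unfold rhoQ
  linarith

/-- **(5.15), lower half**: `δ_{q+1} λ_q^{-α} / 8 ≤ ρ_q(t)` on `[0,T]`, given (5.2) and
`4δ_{q+2} ≤ δ_{q+1}λ_q^{-α}` (true for `a` large, `BDSV.exists_threshold_four_amp`). [cite: BuckmasterEtAl2018, Lemma 5.4 (5.15)] -/
theorem PerturbationHypotheses.le_rhoQ (H : PerturbationHypotheses P S Nbar Cin C₀)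
    (h4 : 4 * amp P.β P.a P.b (S.q + 2) ≤ amp P.β P.a P.b (S.q + 1) * freq P.a P.b S.q ^ (-P.α))
    {t : ℝ} (ht : t ∈ Icc 0 S.T) :
    amp P.β P.a P.b (S.q + 1) * freq P.a P.b S.q ^ (-P.α) / 8 ≤ rhoQ P S t := by
  have h1 := (H.energy_gap t ht).1
  unfold rhoQ
  linarith

/-- **Pointwise `∑_i η_i² ≤ 1`**: at every point at most one cut-off is nonzero (property (ii)) and
`η_i ≤ 1`. [cite: BuckmasterEtAl2018, §5.2 (i)–(ii)] -/
theorem CutoffFamily.sum_sq_le_one {T τ c₀' : ℝ} {Cη' : ℕ → ℕ → ℝ} (cut : CutoffFamily T τ c₀' Cη')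
    (s : Finset ℕ) (t : ℝ) (x : 𝕋³) : ∑ i ∈ s, cut.η i t x ^ 2 ≤ 1 := by
  by_cases h : ∃ i ∈ s, cut.η i t x ≠ 0
  · obtain ⟨i₀, hi₀, hne⟩ := h
    rw [Finset.sum_eq_single_of_mem i₀ hi₀ fun j _ hj => by
      rcases cut.disjoint j i₀ hj t x with h' | h'
      · rw [h']; ring
      · exact absurd h' hne]
    have h1 := cut.nonneg i₀ t x
    have h2 := cut.le_one i₀ t x
    nlinarith
  · push Not at h
    rw [Finset.sum_eq_zero fun i hi => by rw [h i hi]; ring]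
    exact zero_le_one

/-- **(5.19), upper half**: `∑_j ∫ η_j² ≤ 1` (the source states `≤ 2`). [cite: BuckmasterEtAl2018, Lemma 5.4 (5.19)] -/
theorem PerturbationData.etaMass_le_one
    (𝒟 : PerturbationData P S c₀ Cη) {t : ℝ} (ht : t ∈ Icc 0 S.T) : etaMass P S 𝒟.cut.η t ≤ 1 := by
  have hint : ∀ i, Integrable (fun y => 𝒟.cut.η i t y ^ 2) volume := fun i => by
    have h := ((𝒟.cut.smooth i).isSmooth_slice ht)
    have h2 : IsSmooth (fun y => 𝒟.cut.η i t y * 𝒟.cut.η i t y) := by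
      unfold IsSmooth; exact ContDiff.mul h h
    exact h2.integrable.congr (ae_of_all _ fun y => by simp [pow_two])
  unfold etaMass
  rw [← integral_finsetSum _ fun i _ => hint i]
  calc ∫ y, ∑ i ∈ Finset.range (cutoffCount S.T (P.τ S.q)), 𝒟.cut.η i t y ^ 2
      ≤ ∫ _ : 𝕋³, (1 : ℝ) := integral_mono (integrable_finsetSum _ fun i _ => hint i) (integrable_const 1)
          fun y => 𝒟.cut.sum_sq_le_one _ t y
    _ = 1 := by simp

/-- **(5.19), lower half**: `c₀ ≤ ∑_j ∫ η_j²` on `[0,T]` (property (v)). [cite: BuckmasterEtAl2018, Lemma 5.4 (5.19)] -/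
theorem PerturbationData.le_etaMass (𝒟 : PerturbationData P S c₀ Cη) {t : ℝ} (ht : t ∈ Icc 0 S.T) :
    c₀ ≤ etaMass P S 𝒟.cut.η t :=
  𝒟.cut.sum_sq_ge t ht

/-- **(5.16)**: `0 ≤ ρ_{q,i} ≤ δ_{q+1}/c₀` on `[0,T]` (given `0 ≤ ρ_q ≤ δ_{q+1}`, `c₀ ≤ ∑∫η² `, `c₀ > 0`).
[cite: BuckmasterEtAl2018, Lemma 5.4 (5.16)] -/
theorem PerturbationData.rhoI_le (H : PerturbationHypotheses P S Nbar Cin C₀) (𝒟 : PerturbationData P S c₀ Cη)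
    (hc₀ : 0 < c₀) (ha : 1 ≤ P.a) (hρ : ∀ t ∈ Icc 0 S.T, 0 ≤ rhoQ P S t) {t : ℝ} (ht : t ∈ Icc 0 S.T)
    (i : ℕ) (x : 𝕋³) :
    0 ≤ rhoI P S 𝒟.cut.η i t x ∧ rhoI P S 𝒟.cut.η i t x ≤ amp P.β P.a P.b (S.q + 1) / c₀ := by
  have hm : c₀ ≤ etaMass P S 𝒟.cut.η t := 𝒟.le_etaMass ht
  have hm0 : 0 < etaMass P S 𝒟.cut.η t := hc₀.trans_le hm
  have hη2 : 𝒟.cut.η i t x ^ 2 ≤ 1 := by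
    have h1 := 𝒟.cut.nonneg i t x; have h2 := 𝒟.cut.le_one i t x; nlinarith
  have hq : 0 ≤ rhoQ P S t / etaMass P S 𝒟.cut.η t := div_nonneg (hρ t ht) hm0.le
  unfold rhoI
  refine ⟨mul_nonneg (sq_nonneg _) hq, ?_⟩
  calc 𝒟.cut.η i t x ^ 2 * (rhoQ P S t / etaMass P S 𝒟.cut.η t)
      ≤ 1 * (rhoQ P S t / etaMass P S 𝒟.cut.η t) := mul_le_mul_of_nonneg_right hη2 hq
    _ ≤ amp P.β P.a P.b (S.q + 1) / c₀ := by
        rw [one_mul]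
        exact div_le_div₀ (amp_pos ha _).le (H.rhoQ_le ha ht) hc₀ hm

end Rho

end BDSV

end Literature.Analysis.FluidPDE
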